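import Summits.ResolutionOfSingularities.KangarooAtlas.MizutaniDichotomyHironaka
import Summits.ResolutionOfSingularities.KangarooAtlas.MizutaniSchemeIdentity
import HarnessLib

/-!
# Two sanity examples for the typing of `B_{P,𝔭}`: the generic point of `ℙ^n` and a `k`-rational point

Cell `pub-rosobs`, Mizutani enclosure (seat mizutani-encloser-2, gen 5). AI-written; AI review is weaker than expert
review; NOT a resolution-of-singularities theorem (summit relevance C).

Reviewer-facing checks that the transcriptions (`symbPow` / `hirForms` / `multAlgebra` / `bIdeal` of
`Literature/…/HironakaGroupSchemeMultiplicity.lean`, `IsPoint` of `…/HironakaGroupScheme.lean`) compute the expected Hironaka schemes in the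
two simplest cases:

* THE GENERIC POINT `𝔭 = (0)` of `ℙ^n_k` (it is an `IsPoint`: `isPoint_bot`): `𝔭^{(d)} = 0` for `d ≥ 1` (`symbPow_bot`), `U(0) ∩ L = 0`
  (`hirForms_bot`), `U_+(0)S = 0` (`bIdeal_bot`), so **`B_{P,(0)} = Spec S = 𝔸^{n+1}`** of dimension `n + 1` (`ringKrullDim_quotient_bIdeal_bot`),
  exponent `0` (`exponent_bot`), a vector group (`isVectorGroup_bot`);
* THE `k`-RATIONAL POINT `[1 : 0 : ⋯ : 0]`, `𝔭₀ = (X_1, …, X_n)` (`coordPoint`, `isPoint_coordPoint`): `(U(𝔭₀) ∩ L)_e = {a : a_0 = 0}` for every `e`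
  (`mem_hirForms_coordPoint_iff`: an additive form `Σ a_i X_i^{p^e}` has multiplicity `p^e` at the point iff it omits `X_0`), `U_+(𝔭₀)S = 𝔭₀`
  (`bIdeal_coordPoint`), so **`B_{P,𝔭₀} = V(X_1, …, X_n)` is the LINE over the point**, of dimension `1` (`ringKrullDim_quotient_bIdeal_coordPoint`),
  a vector group (`isVectorGroup_coordPoint`), exponent `0` (`exponent_coordPoint`).

## References

* H. Mizutani, *Hironaka's additive group schemes*, Nagoya Math. J. 52 (1973), Def. 1.1, Rem. 1.2. [Mizutani1973HironakaGroupSchemes]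
-/

noncomputable section

open MvPolynomial Literature.AlgebraicGeometry.Resolution Literature.AlgebraicGeometry.Resolution.HironakaScheme
open Literature.RingTheory.MvPolynomial Literature.RingTheory.HilbertSamuel

namespace Summit.ResolutionOfSingularities.KangarooAtlas.Mizutani

universe u

/-! ## The generic point `𝔭 = (0)` -/

section Generic

variable (k : Type u) [Field k] (p : ℕ) [hp : Fact p.Prime] [CharP k p] (n : ℕ)

omit hp [CharP k p] in
/-- The generic point of `ℙ^n_k` (the zero ideal) is a point in the typing's sense. [cite: Mizutani1973HironakaGroupSchemes, §1 (p ∈ Pⁿ)] -/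
theorem isPoint_bot : IsPoint k (⊥ : Ideal (MvPolynomial (Fin (n + 1)) k)) := by
  refine ⟨Ideal.isPrime_bot, fun f hf d => ?_, fun hle => ?_⟩
  · rw [Ideal.mem_bot] at hf ⊢
    rw [hf, map_zero]
  · have hX : (X 0 : MvPolynomial (Fin (n + 1)) k) ∈ irrelevant k n := by
      unfold irrelevant; rw [RingHom.mem_ker, constantCoeff_X]
    exact X_ne_zero (R := k) (0 : Fin (n + 1)) (Ideal.mem_bot.mp (hle hX))

omit hp [CharP k p] in
/-- `(0)^{(d)} = 0` for `d ≥ 1` (a domain). [folklore] -/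
theorem symbPow_bot {d : ℕ} (hd : 1 ≤ d) : symbPow k (⊥ : Ideal (MvPolynomial (Fin (n + 1)) k)) d = {0} := by
  ext f
  constructor
  · rintro ⟨s, hs, hsf⟩
    have hbot : (⊥ : Ideal (MvPolynomial (Fin (n + 1)) k)) ^ d = ⊥ := by
      rw [← Ideal.zero_eq_bot, zero_pow (by omega)]
    rw [hbot, Ideal.mem_bot] at hsf
    rw [Ideal.mem_bot] at hs
    exact (mul_eq_zero.mp hsf).resolve_left hs
  · intro hf
    rw [Set.mem_singleton_iff] at hf
    refine ⟨1, by rw [Ideal.mem_bot]; exact one_ne_zero, ?_⟩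
    rw [hf, mul_zero]
    exact Ideal.zero_mem _

omit [CharP k p] in
/-- **`U((0)) ∩ L = 0`**: no nonzero additive form has multiplicity `p^e ≥ 1` at the generic point. [cite: Mizutani1973HironakaGroupSchemes, §1 (c)] -/
theorem hirForms_bot (e : ℕ) : hirForms k p (⊥ : Ideal (MvPolynomial (Fin (n + 1)) k)) e = ⊥ := by
  rw [eq_bot_iff]
  intro a ha
  have h : addForm k p e a ∈ symbPow k (⊥ : Ideal (MvPolynomial (Fin (n + 1)) k)) (p ^ e) := mem_hirForms_iff.mp ha
  rw [symbPow_bot k n (Nat.one_le_pow _ _ hp.out.pos), Set.mem_singleton_iff] at h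
  rw [Submodule.mem_bot]
  refine addForm_injective k p e ?_
  rw [h]
  unfold addForm
  simp

/-- **`U_+((0))S = 0`: the Hironaka scheme of the generic point is all of `Spec S = 𝔸^{n+1}`.** [cite: Mizutani1973HironakaGroupSchemes, Def. 1.1] -/
theorem bIdeal_bot : bIdeal k (⊥ : Ideal (MvPolynomial (Fin (n + 1)) k)) = ⊥ :=
  le_bot_iff.mp (bIdeal_le (𝔭 := (⊥ : Ideal (MvPolynomial (Fin (n + 1)) k))))

omit hp [CharP k p] in
/-- `dim B_{P,(0)} = n + 1`. [cite: Mizutani1973HironakaGroupSchemes, Thm. 1.3] -/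
theorem ringKrullDim_quotient_bIdeal_bot :
    ringKrullDim (MvPolynomial (Fin (n + 1)) k ⧸ bIdeal k (⊥ : Ideal (MvPolynomial (Fin (n + 1)) k))) = (n + 1 : ℕ) := by
  rw [bIdeal_bot, ringKrullDim_eq_of_ringEquiv (RingEquiv.quotientBot (MvPolynomial (Fin (n + 1)) k)),
    MvPolynomial.ringKrullDim_of_isNoetherianRing, ringKrullDim_eq_zero_of_field, zero_add, Nat.card_eq_fintype_card,
    Fintype.card_fin]

/-- The generic point has exponent `0`. [cite: Mizutani1973HironakaGroupSchemes, §1 (c)] -/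
theorem exponent_bot : exponent k p (⊥ : Ideal (MvPolynomial (Fin (n + 1)) k)) = 0 := by
  refine Nat.le_zero.mp ((exponent_le_iff k p _).mpr ?_)
  rw [exponentLE_iff_hirForms]
  intro j _
  have h0 : frobVec k p (j - 0) (0 : Fin (n + 1) → k) = 0 := by
    funext i
    simp [frobVec, zero_pow (pow_ne_zero _ hp.out.ne_zero)]
  rw [hirForms_bot, hirForms_bot, Submodule.bot_coe, Set.image_singleton, h0]
  exact (Submodule.span_zero_singleton k).symm

include p hp in
/-- `B_{P,(0)}` is a vector group. [cite: Mizutani1973HironakaGroupSchemes, Rem. 1.2] -/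
theorem isVectorGroup_bot : IsVectorGroup k (⊥ : Ideal (MvPolynomial (Fin (n + 1)) k)) :=
  (isVectorGroup_iff_exponent_eq_zero_holds k p _ (isPoint_bot k n)).mpr (exponent_bot k p n)

end Generic

/-! ## The rational point `[1 : 0 : ⋯ : 0]` -/

section Rational

variable (k : Type u) [Field k] (p : ℕ) [hp : Fact p.Prime] [CharP k p] (n : ℕ)

/-- The homogeneous prime `𝔭₀ = (X_1, …, X_n)` of the `k`-rational point `[1 : 0 : ⋯ : 0]` of `ℙ^n_k`.
[cite: Mizutani1973HironakaGroupSchemes, §1 (p ∈ Pⁿ)] -/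
def coordPoint : Ideal (MvPolynomial (Fin (n + 1)) k) :=
  Ideal.span (X '' (↑((Finset.univ : Finset (Fin (n + 1))).erase 0) : Set (Fin (n + 1))))

omit hp [CharP k p] in
/-- `𝔭₀` is the kernel of "kill `X_1, …, X_n`". [folklore] -/
theorem coordPoint_eq_ker : coordPoint k n = RingHom.ker (killFin (k := k) ((Finset.univ : Finset (Fin (n + 1))).erase 0)) := by
  rw [coordPoint, ker_killFin]

omit hp [CharP k p] in
/-- `𝔭₀` is prime. [folklore] -/
theorem coordPoint_isPrime : (coordPoint k n).IsPrime := by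
  rw [coordPoint_eq_ker]
  exact RingHom.ker_isPrime _

omit hp [CharP k p] in
/-- `X_i ∈ 𝔭₀` for `i ≠ 0`, and `X_0 ∉ 𝔭₀`. [folklore] -/
theorem X_mem_coordPoint_iff (i : Fin (n + 1)) : (X i : MvPolynomial (Fin (n + 1)) k) ∈ coordPoint k n ↔ i ≠ 0 := by
  classical
  constructor
  · intro h hi
    subst hi
    rw [coordPoint_eq_ker, RingHom.mem_ker] at h
    have h' : killFin (k := k) ((Finset.univ : Finset (Fin (n + 1))).erase 0) (X 0) =
        X ⟨0, by simp⟩ := by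
      rw [killFin, aeval_X, dif_neg (by simp)]
    rw [h'] at h
    exact X_ne_zero _ h
  · intro hi
    exact Ideal.subset_span ⟨i, by simp [hi], rfl⟩

omit hp [CharP k p] in
/-- `𝔭₀` is a point of `ℙ^n_k`. [cite: Mizutani1973HironakaGroupSchemes, §1 (p ∈ Pⁿ)] -/
theorem isPoint_coordPoint : IsPoint k (coordPoint k n) := by
  refine ⟨coordPoint_isPrime k n, ?_, fun hle => ?_⟩
  · exact isHomogeneousIdeal_span_of_isHomogeneous (by
      rintro _ ⟨i, -, rfl⟩
      exact ⟨1, isHomogeneous_X k i⟩)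
  · have hX : (X 0 : MvPolynomial (Fin (n + 1)) k) ∈ irrelevant k n := by
      unfold irrelevant; rw [RingHom.mem_ker, constantCoeff_X]
    exact ((X_mem_coordPoint_iff k n 0).mp (hle hX)) rfl

omit [CharP k p] in
/-- **`(U(𝔭₀) ∩ L)_e = {a : a_0 = 0}`**: `Σ a_i X_i^{p^e}` has multiplicity `p^e` at `[1:0:⋯:0]` iff it omits `X_0`.
[cite: Mizutani1973HironakaGroupSchemes, §1 (c), Def. 1.1] -/
theorem mem_hirForms_coordPoint_iff (e : ℕ) (a : Fin (n + 1) → k) :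
    (haveI := coordPoint_isPrime k n; a ∈ hirForms k p (coordPoint k n) e) ↔ a 0 = 0 := by
  classical
  haveI := coordPoint_isPrime k n
  set J : Finset (Fin (n + 1)) := (Finset.univ : Finset (Fin (n + 1))).erase 0 with hJ
  have h0J : (0 : Fin (n + 1)) ∉ J := by simp [hJ]
  have hq : 1 ≤ p ^ e := Nat.one_le_pow _ _ hp.out.pos
  constructor
  · intro ha
    -- `addForm e a ∈ 𝔭₀`; kill `X_1, …, X_n`: only `a_0 X_0^q` survives
    have hmem : addForm k p e a ∈ coordPoint k n := mem_of_mem_symbPow hq (mem_hirForms_iff.mp ha)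
    rw [coordPoint_eq_ker, RingHom.mem_ker] at hmem
    have hφ : killFin (k := k) J (addForm k p e a) = C (a 0) * X ⟨0, h0J⟩ ^ p ^ e := by
      unfold addForm
      rw [map_sum, Finset.sum_eq_single (0 : Fin (n + 1))]
      · rw [map_mul, map_pow, killFin, aeval_C, aeval_X, dif_neg h0J, MvPolynomial.algebraMap_eq]
      · intro i _ hi
        rw [map_mul, map_pow, killFin, aeval_X, dif_pos (by simp [hJ, hi]), zero_pow (by omega), mul_zero]
      · intro h
        exact absurd (Finset.mem_univ _) h
    rw [hφ, C_mul_X_pow_eq_monomial, monomial_eq_zero] at hmem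
    exact hmem
  · intro h0
    refine mem_hirForms_iff.mpr ⟨1, fun h1 => (coordPoint_isPrime k n).ne_top ((Ideal.eq_top_iff_one _).mpr h1), ?_⟩
    rw [one_mul]
    unfold addForm
    refine Ideal.sum_mem _ fun i _ => ?_
    by_cases hi : i = 0
    · subst hi
      rw [h0, C_0, zero_mul]
      exact Ideal.zero_mem _
    · exact Ideal.mul_mem_left _ _ (Ideal.pow_mem_pow ((X_mem_coordPoint_iff k n i).mpr hi) _)

omit hp [CharP k p] in
/-- `X_i = addForm 0 (e_i)`: the variables are the additive forms of level `0` with unit coefficient vectors. [folklore] -/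
theorem addForm_zero_single (p : ℕ) (i : Fin (n + 1)) :
    addForm k p 0 (Pi.single i 1) = X i := by
  classical
  unfold addForm
  rw [Finset.sum_eq_single i]
  · rw [Pi.single_eq_same, C_1, one_mul, pow_zero, pow_one]
  · intro j _ hj
    rw [Pi.single_eq_of_ne hj, C_0, zero_mul]
  · intro h
    exact absurd (Finset.mem_univ _) h

include p hp in
/-- **`U_+(𝔭₀)S = 𝔭₀`: the Hironaka scheme of the rational point `[1:0:⋯:0]` is the LINE `X_1 = ⋯ = X_n = 0` over it.**
[cite: Mizutani1973HironakaGroupSchemes, Def. 1.1] -/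
theorem bIdeal_coordPoint : bIdeal k (coordPoint k n) = coordPoint k n := by
  classical
  haveI := coordPoint_isPrime k n
  refine le_antisymm bIdeal_le ?_
  conv_lhs => rw [coordPoint]
  refine Ideal.span_le.mpr ?_
  rintro _ ⟨i, hi, rfl⟩
  have hi0 : i ≠ 0 := by simpa using hi
  have hmem : (Pi.single i 1 : Fin (n + 1) → k) ∈ hirForms k p (coordPoint k n) 0 :=
    (mem_hirForms_coordPoint_iff k p n 0 _).mpr (by simp [Ne.symm hi0])
  have h := (addForm_mem_bIdeal_iff k p (coordPoint k n) (isPoint_coordPoint k n)).mpr hmem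
  rwa [addForm_zero_single] at h

include hp in
/-- `dim B_{P,𝔭₀} = 1`. [cite: Mizutani1973HironakaGroupSchemes, Thm. 1.3] -/
theorem ringKrullDim_quotient_bIdeal_coordPoint :
    ringKrullDim (MvPolynomial (Fin (n + 1)) k ⧸ bIdeal k (coordPoint k n)) = (1 : ℕ) := by
  classical
  rw [bIdeal_coordPoint k p n, coordPoint, ringKrullDim_quotient_span_X]
  congr 1
  rw [Finset.card_erase_of_mem (Finset.mem_univ _), Finset.card_univ, Fintype.card_fin]
  simp

include hp in
/-- `B_{P,𝔭₀}` is a vector group (its ideal is generated by the linear forms `X_1, …, X_n`). [cite: Mizutani1973HironakaGroupSchemes, Rem. 1.2] -/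
theorem isVectorGroup_coordPoint : IsVectorGroup k (coordPoint k n) := by
  unfold IsVectorGroup
  rw [bIdeal_coordPoint k p n]
  refine le_antisymm ?_ (Ideal.span_le.mpr fun _ hf => hf.1)
  conv_lhs => rw [coordPoint]
  refine Ideal.span_mono ?_
  rintro _ ⟨i, hi, rfl⟩
  exact ⟨(X_mem_coordPoint_iff k n i).mpr (by simpa using hi), isHomogeneous_X k i⟩

/-- `𝔭₀` has exponent `0`. [cite: Mizutani1973HironakaGroupSchemes, §1 (c), Rem. 1.2] -/
theorem exponent_coordPoint : exponent k p (coordPoint k n) = 0 := by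
  haveI := coordPoint_isPrime k n
  exact (isVectorGroup_iff_exponent_eq_zero_holds k p _ (isPoint_coordPoint k n)).mp (isVectorGroup_coordPoint k p n)

end Rational

end Summit.ResolutionOfSingularities.KangarooAtlas.Mizutani

end
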